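import Summits.HubbardSuperconductivity.HubbardSuperconductivity.Theorems.AnisotropyChordFerroSideChordFour
import Summits.HubbardSuperconductivity.HubbardSuperconductivity.Theorems.AnisotropyChordFourTorusKernelAgreeN0
import Summits.HubbardSuperconductivity.HubbardSuperconductivity.Theorems.AnisotropyChordFourTorusKernelAgreeN1
import Summits.HubbardSuperconductivity.HubbardSuperconductivity.Theorems.AnisotropyChordFourTorusKernelAgreeN2
import Summits.HubbardSuperconductivity.HubbardSuperconductivity.Theorems.AnisotropyChordFourTorusKernelAgreeN3

/-!
# Route `AnisotropyChord`: **the crux `ChordFM` (Tier-B chord, stmt-HubbardSuperconductivity-8147) HOLDS AT `M = 4`** — a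
# kernel-certified instance for every `Δ ∈ [-1, 1]` (prover seat `hubbard-h0-rotor-p1` g17; `--supports stmt-8147`)

`chordFM_four` is the body of `Theses.AnisotropyChord.ChordFM` with `M := 4`: for every `Δ ∈ [-1,1]` and every normalised
`Sᶻ_tot = 0` sector ground state `ψ` of `H₄(Δ) = xxzHamiltonian 1 (torusGraph 2 4) (−1) Δ`, `(1+Δ)/2 · (8 · 9) ≤ Re⟨ψ, S⁺_tot S⁻_tot ψ⟩`
— the chord from the exact ferromagnetic value `72` at `Δ = 1` down to `0` at the antiferromagnetic point, on the `4 × 4` torus.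
The ferromagnetic-Ising side `[0,1]` is `…FerroSideChordFour` (`c = 30`); this file adds the antiferromagnetic-Ising side `[-1,0]`
with the constant `c = 10` on the affine piece `[-1,0]`: `(−Δ)·Q₋₁ + (1+Δ)·Q₀' = 30·[L − 36(1+Δ)N + 10(A + (1−Δ)W + (8/15)(1−Δ)N)]`
with both literal matrices kernel-certified strictly positive definite (`…FourTorusKernelNeg`, `…FourTorusKernelAgreeN0…3`).
Numerically `Λ(−1) = 47.2`, `Λ(−½) = 62.7 ≥ 18`, `Λ(0) = 68.0 ≥ 36`; `λ_min` of the two scaled certificate matrices `2.7`, `1.7`.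
-/

set_option linter.style.longLine false
set_option linter.dupNamespace false
set_option autoImplicit false

open Finset Matrix
open Literature.MathematicalPhysics.QuantumLattice Literature.Probability.LatticeModels
open Summit.HubbardSuperconductivity.HubbardSuperconductivity.Theorems.AnisotropyChord.Tower
open Summit.HubbardSuperconductivity.HubbardSuperconductivity.Theorems.AnisotropyChord.InsertionEntropy
open Summit.HubbardSuperconductivity.HubbardSuperconductivity.Theorems.AnisotropyChord.Transfer
open Summit.HubbardSuperconductivity.HubbardSuperconductivity.Theorems.AnisotropyChord.Stiffness

namespace Summit.HubbardSuperconductivity.HubbardSuperconductivity.Theorems.AnisotropyChord.FourTorus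

/-! ## The two certificates, read into `ℝ` -/

/-- the real quadratic form of the literal matrix `30·M₁₀(Δ)`, `Δ = D − 1`. [folklore] -/
noncomputable def quadLitN (D : ℕ) (v : ℕ → ℝ) : ℝ := ∑ i ∈ range 58, ∑ j ∈ range 58, v i * v j * (pLitN D i j : ℝ)

/-- the residual entry as a `Finset` sum. [folklore] -/
theorem residN_eq (D i j : ℕ) : residN D i j = 2 ^ 32 * pLitN D i j - ∑ k ∈ range 58, cholLitN D i k * cholLitN D j k := by
  unfold residN; rw [iter_add_eq, zero_add]

/-- `certDomN D = true`, unpacked. [folklore] -/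
theorem dominant_of_certDomN {D : ℕ} (h : certDomN D = true) :
    ∀ i < 58, (∑ j ∈ range 58, if j = i then 0 else |(2 : ℤ) ^ 32 * pLitN D i j - ∑ k ∈ range 58, cholLitN D i k * cholLitN D j k|)
      ≤ 2 ^ 32 * pLitN D i i - ∑ k ∈ range 58, cholLitN D i k * cholLitN D i k := by
  intro i hi
  have hd := allN_sound h i hi
  rw [decide_eq_true_eq] at hd
  unfold offSumN at hd
  rw [sumN_eq, residN_eq] at hd
  push_cast at hd
  refine le_trans (le_of_eq ?_) hd
  refine Finset.sum_congr rfl fun j _ => ?_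
  split_ifs
  · rfl
  · rw [residN_eq]

/-- `certSymN D = true`, unpacked. [folklore] -/
theorem symm_of_certSymN {D : ℕ} (h : certSymN D = true) : ∀ i < 58, ∀ j < 58, pLitN D i j = pLitN D j i := by
  intro i hi j hj
  have := allN_sound (allN_sound h i hi) j hj
  rwa [beq_iff_eq] at this

/-- **both literal matrices of the piece `[-1,0]` are positive semidefinite.** [folklore] -/
theorem quadLitN_nonneg {D : ℕ} (hD : D = 0 ∨ D = 1) (v : ℕ → ℝ) : 0 ≤ quadLitN D v := by
  have hdom : certDomN D = true := hD.elim (fun h => by subst h; exact certDomN_zero) (fun h => by subst h; exact certDomN_one)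
  have hsym : certSymN D = true := hD.elim (fun h => by subst h; exact certSymN_zero) (fun h => by subst h; exact certSymN_one)
  exact psd_of_dominant_residual 58 (2 ^ 32) (by norm_num) (pLitN D) (cholLitN D) (symm_of_certSymN hsym)
    (dominant_of_certDomN hdom) v

/-! ## The assembled matrix in class variables -/

/-- the quadratic form of the assembled matrix `pEntryN D`. [folklore] -/
noncomputable def quadEntryN (D : ℕ) (v : ℕ → ℝ) : ℝ := ∑ r ∈ range 58, ∑ s ∈ range 58, v r * v s * (pEntryN D r s : ℝ)

/-- **the assembled matrix, expanded:**
`Σ v v pEntryN D = 30 L(v) + 300 A(v) + Σ_r n8 r v_r² (−1080 D + (2−D)(2400 − 150 A_r) + 160(2−D))`. [folklore] -/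
theorem quadEntryN_eq (D : ℕ) (v : ℕ → ℝ) :
    quadEntryN D v = 30 * lowerC v + 300 * hopC v
      + ∑ r ∈ range 58, (n8 r : ℝ) * (-1080 * (D : ℝ) + (2 - (D : ℝ)) * (2400 - 150 * (activeEdges r : ℝ)) + 160 * (2 - (D : ℝ))) * v r ^ 2 := by
  unfold quadEntryN pEntryN
  push_cast
  have e : ∀ r ∈ range 58, ∀ s ∈ range 58,
      v r * v s * (30 * (lEntry r s : ℝ) + 75 * (hEntry r s : ℝ)
        + (if r = s then (n8 r : ℝ) * (-1080 * (D : ℝ) + (2 - (D : ℝ)) * (2400 - 150 * (activeEdges r : ℝ)) + 160 * (2 - (D : ℝ))) else 0))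
      = 30 * (v r * v s * (lEntry r s : ℝ)) + 75 * (v r * v s * (hEntry r s : ℝ))
        + v r * v s * (if r = s then (n8 r : ℝ) * (-1080 * (D : ℝ) + (2 - (D : ℝ)) * (2400 - 150 * (activeEdges r : ℝ)) + 160 * (2 - (D : ℝ))) else 0) := by
    intro r _ s _; ring
  rw [Finset.sum_congr rfl (fun r hr => Finset.sum_congr rfl (fun s hs => e r hr s hs))]
  simp only [Finset.sum_add_distrib, ← Finset.mul_sum]
  rw [quad_lEntry, quad_hEntry_eq_hOff, quad_hOff, quad_diag]
  ring

/-- `Δ = -1`: `Σ v v pEntryN 0 = 30 L + 300 A + 600 W + 320 N`. [folklore] -/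
theorem quadEntryN_zero_eq (v : ℕ → ℝ) : quadEntryN 0 v = 30 * lowerC v + 300 * hopC v + 600 * isingC v + 320 * normC v := by
  rw [quadEntryN_eq]
  push_cast
  have hs : ∑ r ∈ range 58, (n8 r : ℝ) * (-1080 * 0 + (2 - 0) * (2400 - 150 * (activeEdges r : ℝ)) + 160 * (2 - 0)) * v r ^ 2
      = 600 * isingC v + 320 * normC v := by
    unfold isingC normC
    rw [Finset.mul_sum, Finset.mul_sum, ← Finset.sum_add_distrib]
    exact Finset.sum_congr rfl fun r _ => by ring
  rw [hs]; ring

/-- `Δ = 0`, `c = 10`: `Σ v v pEntryN 1 = 30 L + 300 A + 300 W − 920 N`. [folklore] -/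
theorem quadEntryN_one_eq (v : ℕ → ℝ) : quadEntryN 1 v = 30 * lowerC v + 300 * hopC v + 300 * isingC v - 920 * normC v := by
  rw [quadEntryN_eq]
  push_cast
  have hs : ∑ r ∈ range 58, (n8 r : ℝ) * (-1080 * 1 + (2 - 1) * (2400 - 150 * (activeEdges r : ℝ)) + 160 * (2 - 1)) * v r ^ 2
      = 300 * isingC v - 920 * normC v := by
    unfold isingC normC
    rw [Finset.mul_sum, Finset.mul_sum, ← Finset.sum_sub_distrib]
    exact Finset.sum_congr rfl fun r _ => by ring
  rw [hs]; ring

/-- `pAgreeN`, unpacked. [folklore] -/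
theorem pEntryN_eq_pLitN {D r s : ℕ} (hD : D = 0 ∨ D = 1) (hr : r < 58) (hs : s < 58) : pEntryN D r s = pLitN D r s := by
  have key : ∀ h < 2, pAgreeN D h = true → ∀ i < 29, ∀ s < 58, pEntryN D (29 * h + i) s = pLitN D (29 * h + i) s := by
    intro h _ hp i hi s hs
    have := allN_sound (allN_sound hp i hi) s hs
    rwa [beq_iff_eq] at this
  have hlo : pAgreeN D 0 = true := hD.elim (fun h => by subst h; exact pAgreeN_m1_lo) (fun h => by subst h; exact pAgreeN_z_lo)
  have hhi : pAgreeN D 1 = true := hD.elim (fun h => by subst h; exact pAgreeN_m1_hi) (fun h => by subst h; exact pAgreeN_z_hi)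
  by_cases hlt : r < 29
  · have := key 0 (by norm_num) hlo r hlt s hs; simpa using this
  · have := key 1 (by norm_num) hhi (r - 29) (by omega) s hs
    rwa [show 29 * 1 + (r - 29) = r by omega] at this

/-- the assembled form is the certified literal form (`D ∈ {0,1}`). [folklore] -/
theorem quadEntryN_eq_quadLitN {D : ℕ} (hD : D = 0 ∨ D = 1) (v : ℕ → ℝ) : quadEntryN D v = quadLitN D v := by
  unfold quadEntryN quadLitN
  refine Finset.sum_congr rfl fun r hr => Finset.sum_congr rfl fun s hs => ?_
  rw [pEntryN_eq_pLitN hD (mem_range.1 hr) (mem_range.1 hs)]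

/-- **main inequality on `[-1, 0]`:** `0 ≤ L(v) − 36(1+Δ) N(v) + 10 (A(v) + (1−Δ) W(v) + (8/15)(1−Δ) N(v))`. [folklore] -/
theorem main_form_nonneg_neg {Δ : ℝ} (h0 : -1 ≤ Δ) (h1 : Δ ≤ 0) (v : ℕ → ℝ) :
    0 ≤ lowerC v - 36 * (1 + Δ) * normC v + 10 * (hopC v + (1 - Δ) * isingC v + (8/15 : ℝ) * (1 - Δ) * normC v) := by
  have hq0 := quadLitN_nonneg (Or.inl rfl) v
  have hq1 := quadLitN_nonneg (Or.inr rfl) v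
  rw [← quadEntryN_eq_quadLitN (Or.inl rfl), quadEntryN_zero_eq] at hq0
  rw [← quadEntryN_eq_quadLitN (Or.inr rfl), quadEntryN_one_eq] at hq1
  have hnn : 0 ≤ (-Δ) * (30 * lowerC v + 300 * hopC v + 600 * isingC v + 320 * normC v)
      + (1 + Δ) * (30 * lowerC v + 300 * hopC v + 300 * isingC v - 920 * normC v) :=
    add_nonneg (mul_nonneg (by linarith) hq0) (mul_nonneg (by linarith) hq1)
  nlinarith [hnn]

/-- **the condensate of the sector-`0` Perron amplitude of `H₄(Δ)` lies above the chord on `[-1, 0]`.** [folklore] -/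
theorem lowerNormSq_ge_chord_neg {Δ : ℝ} (h0 : -1 ≤ Δ) (h1 : Δ ≤ 0) {a : Cfg → ℝ} (ha : IsPerronSectorGroundAmplitude 4 Δ 0 a) :
    36 * (1 + Δ) ≤ lowerNormSq a := by
  set v : ℕ → ℝ := fun r => a (decode (rep8 r)) with hv
  have hN : normC v = 1 := by
    unfold normC; rw [← ha.unit, sum_sq_eq_classes ha]
  have hW : ∑ σ, isingW (torusGraph 2 4) σ * a σ ^ 2 = isingC v := by
    unfold isingC; rw [sum_isingW_sq_eq_classes ha]
  have hL : lowerNormSq a = lowerC v := by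
    unfold lowerC; rw [lowerNormSq_eq_classes ha]
  have hA : ∑ σ, a σ * fmOp (torusGraph 2 4) a σ = hopC v := by
    unfold hopC; rw [inner_fmOp_eq_classes ha]
  have hE := perron_energy_four ha
  have hsplit : ∑ σ, a σ * (fmOp (torusGraph 2 4) a σ + (1 - Δ) * (isingW (torusGraph 2 4) σ * a σ))
      = (∑ σ, a σ * fmOp (torusGraph 2 4) a σ) + (1 - Δ) * ∑ σ, isingW (torusGraph 2 4) σ * a σ ^ 2 := by
    rw [Finset.mul_sum, ← Finset.sum_add_distrib]
    exact Finset.sum_congr rfl fun σ _ => by ring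
  rw [hsplit, hA, hW] at hE
  have hU := sectorE_le_uniform Δ
  have hmain := main_form_nonneg_neg h0 h1 v
  rw [hN] at hmain
  rw [hL]
  nlinarith [hmain, hE, hU]

/-- **THEOREM (the crux `ChordFM` at `M = 4`, all `Δ ∈ [-1,1]`, kernel-certified):** for every normalised `Sᶻ_tot = 0` sector
ground state `ψ` of `H₄(Δ) = xxzHamiltonian 1 (torusGraph 2 4) (−1) Δ` on the `4 × 4` torus,
`(1+Δ)/2 · ((4²/2)(4²/2 + 1)) ≤ Re⟨ψ, S⁺_tot S⁻_tot ψ⟩` — the body of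
`Summit.HubbardSuperconductivity.HubbardSuperconductivity.Theses.AnisotropyChord.ChordFM` with `M := 4`
(stmt-HubbardSuperconductivity-8147; instance only, the crux asks for every even `M ≥ 4`).
[conjecture: crux ChordFM of route AnisotropyChord — instance `M = 4` proved here] -/
theorem chordFM_four :
    ∀ Δ ∈ Set.Icc (-1:ℝ) 1, ∀ (ψ : TensorIndex (TorusSite 2 4) 2 → ℂ),
      ψ ∈ spinZSector (Λ := TorusSite 2 4) 1 0 → star ψ ⬝ᵥ ψ = 1 →
      Matrix.mulVec (xxzHamiltonian 1 (torusGraph 2 4) (-1) Δ) ψ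
        = ((lowestEnergyInSector 1 (xxzHamiltonian 1 (torusGraph 2 4) (-1) Δ) 0 : ℝ) : ℂ) • ψ →
      (1 + Δ) / 2 * (((4 : ℕ) : ℝ) ^ 2 / 2 * (((4 : ℕ) : ℝ) ^ 2 / 2 + 1))
        ≤ (star ψ ⬝ᵥ Matrix.mulVec ((∑ x : TorusSite 2 4, onSite x (spinRaise 1))
            * (∑ y : TorusSite 2 4, onSite y (spinLower 1))) ψ).re := by
  intro Δ hΔ ψ hψK hψ1 hHψ
  obtain ⟨a, ha⟩ := exists_perron_zero_of_even (L := 4) Δ (by decide)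
  rw [lambda_eq_lowerNormSq_of_sectorGround Δ 0 a ha ψ hψK hψ1 hHψ]
  have h : 36 * (1 + Δ) ≤ lowerNormSq a := by
    rcases le_total Δ 0 with hle | hge
    · exact lowerNormSq_ge_chord_neg hΔ.1 hle ha
    · exact lowerNormSq_ge_chord hge hΔ.2 ha
  push_cast
  nlinarith [h]

end Summit.HubbardSuperconductivity.HubbardSuperconductivity.Theorems.AnisotropyChord.FourTorus
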